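import Mathlib
import HarnessLib
import Summits.Parity.GeneralizedHardyLittlewood.Theses.LiouvilleMAD
import Summits.Parity.GeneralizedHardyLittlewood.Theorems.DilatedChowla.Negative.DilatedChowlaWelch
import Summits.Parity.GeneralizedHardyLittlewood.Theorems.LiouvilleMADDivisorSwitch

/-!
# `FanDecorrelation` ∧ `CosetDecorrelation` (stmt-Parity-13318 / 13317): joint exponent floor `1/2`

Negative lemma (tightness record) for the MAD pair of cruxes of route LiouvilleMAD, by the disprover
of `FanDecorrelation`.  Notation: `Q = ⌊√M⌋ + 1`; `L z = λ(z.toNat)` and the dilated Chowla sum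
`S c n n' M = Σ_{m∈(M,2M]} λ(mn+c)λ(mn'+c)` are the sibling crux's landed objects
(`DilatedTableChowlaBlocks.L`, `DilatedChowlaMirrorDefs.S`); this file names the two sums of the MAD
cruxes, `fan c n n' M k = Σ_{j∈[Q,2Q)} Σ_{(m,m')∈(M,2M]², m−m'=kj} λ(mn+c)λ(m'n'+c)` and
`coset c n n' M j = Σ_{(m,m')∈(M,2M]², m≡m' (j)} λ(mn+c)λ(m'n'+c)` (read-backs `fanDecorrelation_iff`,
`cosetDecorrelation_iff`: both cruxes are `|·| ≤ C·M^{3/4+ϑ}`, `ϑ < 1/4`, definitionally).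

* `divisorSwitch_fan`: the tree theorem `DivisorSwitch_proof` at the crux's summand and `Q = ⌊√M⌋+1`:
  `Q·S + Σ_{0<|k|≤M} fan_k = Σ_{j∈[Q,2Q)} coset_j`.
* `fan_eq_zero_of_abs_ge`: fans are empty for `|k| ≥ 2Q`.
* `mad_not_both_below_half`: for every `e < 1/2` and `C` there are `M` and `1 ≤ n ≠ n' ≤ 2M` (shift
  `c = 1`) with some `|coset_j| > C·M^e`, `j ∈ [Q,2Q)`, or some `|fan_k| > C·M^e`, `k ≠ 0` — by the
  Welch floor `|S 1 n n' M| ≥ √(M/2)` (`exists_abs_S_ge_sqrt`) and the identity, at most `5Q` terms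
  of size `≤ C·M^e` would have to carry `Q·√(M/2)`.
* `mad_exponent_floor`: hence the two decorrelation statements cannot both hold with ANY exponent
  `e < 1/2` in place of `3/4 + ϑ` (already at the single shift `c = 1`): MAD is not a pure
  square-root-cancellation phenomenon; the conjectured truth `3/4 + 0⁺` sits `M^{1/4}` above this
  rigorous floor. [folklore]
-/

noncomputable section

namespace Summit.Parity.GeneralizedHardyLittlewood.Theorems.FanDecorrelation.Negative

open Summit.Parity.GeneralizedHardyLittlewood.Theses.LiouvilleMAD
open Summit.Parity.GeneralizedHardyLittlewood.Theorems.DilatedTableChowla.Negative (L)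
open Summit.Parity.GeneralizedHardyLittlewood.Theorems.DilatedChowla.Negative
  (S exists_abs_S_ge_sqrt)
open Finset Filter

/-! ## §0 The two MAD sums -/

/-- The fan sum of the crux: `fan c n n' M k = Σ_{j∈[Q,2Q)} Σ_{(m,m')∈(M,2M]², m−m'=kj} λ(mn+c)λ(m'n'+c)`,
`Q = ⌊√M⌋+1`. -/
def fan (c : ℤ) (n n' M : ℕ) (k : ℤ) : ℝ :=
  ∑ j ∈ Ico (Nat.sqrt M + 1) (2 * (Nat.sqrt M + 1)),
    ∑ p ∈ (Ioc M (2 * M) ×ˢ Ioc M (2 * M)).filter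
        (fun p : ℕ × ℕ => (p.1 : ℤ) - p.2 = k * (j : ℤ)),
      L ((p.1 : ℤ) * n + c) * L ((p.2 : ℤ) * n' + c)

/-- READ-BACK: the crux is the uniform bound `|fan| ≤ C·M^{3/4+ϑ}` for some `ϑ < 1/4`
(definitional). -/
theorem fanDecorrelation_iff :
    FanDecorrelation ↔ ∀ c : ℤ, c ≠ 0 → ∃ ϑ : ℝ, ϑ < 1 / 4 ∧ ∃ C : ℝ, ∀ M n n' : ℕ, ∀ k : ℤ,
      1 ≤ n → 1 ≤ n' → n ≠ n' → n ≤ 2 * M → n' ≤ 2 * M → k ≠ 0 →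
        |fan c n n' M k| ≤ C * (M : ℝ) ^ (3 / 4 + ϑ) :=
  Iff.rfl

/-- The coset sum of the sibling crux in the same notation:
`coset c n n' M j = Σ_{(m,m')∈(M,2M]², m ≡ m' (mod j)} λ(mn+c)λ(m'n'+c)`. -/
def coset (c : ℤ) (n n' M j : ℕ) : ℝ :=
  ∑ p ∈ (Ioc M (2 * M) ×ˢ Ioc M (2 * M)).filter (fun p : ℕ × ℕ => p.1 ≡ p.2 [MOD j]),
    L ((p.1 : ℤ) * n + c) * L ((p.2 : ℤ) * n' + c)

/-- READ-BACK: the sibling crux `CosetDecorrelation` is the uniform bound `|coset| ≤ C·M^{3/4+ϑ}` for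
some `ϑ < 1/4` (definitional). -/
theorem cosetDecorrelation_iff :
    CosetDecorrelation ↔ ∀ c : ℤ, c ≠ 0 → ∃ ϑ : ℝ, ϑ < 1 / 4 ∧ ∃ C : ℝ, ∀ M n n' j : ℕ,
      1 ≤ n → 1 ≤ n' → n ≠ n' → n ≤ 2 * M → n' ≤ 2 * M → Nat.sqrt M + 1 ≤ j →
        j < 2 * (Nat.sqrt M + 1) → |coset c n n' M j| ≤ C * (M : ℝ) ^ (3 / 4 + ϑ) :=
  Iff.rfl

/-! ## §1 Divisor switching and empty fans -/

/-- DivisorSwitch (tree theorem `DivisorSwitch_proof`) specialised to the crux's summand and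
`Q = ⌊√M⌋+1`: `Q·S + Σ_{0<|k|≤M} fan_k = Σ_{j∈[Q,2Q)} coset_j`. -/
theorem divisorSwitch_fan (c : ℤ) (n n' M : ℕ) :
    ((Nat.sqrt M : ℝ) + 1) * S c n n' M + ∑ k ∈ (Icc (-(M : ℤ)) M).erase 0, fan c n n' M k =
      ∑ j ∈ Ico (Nat.sqrt M + 1) (2 * (Nat.sqrt M + 1)), coset c n n' M j := by
  have h := Summit.Parity.GeneralizedHardyLittlewood.Theorems.DivisorSwitch_proof
    (fun m m' => L ((m : ℤ) * n + c) * L ((m' : ℤ) * n' + c)) M (Nat.sqrt M + 1)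
  have hcard : (Ico (Nat.sqrt M + 1) (2 * (Nat.sqrt M + 1))).card = Nat.sqrt M + 1 := by
    rw [Nat.card_Ico]; omega
  rw [hcard] at h
  unfold fan coset S
  push_cast at h
  exact h

/-- Fans are empty as soon as `|k| ≥ 2Q` (both signs): a pair `(m,m') ∈ (M,2M]²` has `|m − m'| < M < Q²`,
while `|k j| ≥ 2Q·Q`. [folklore] -/
theorem fan_eq_zero_of_abs_ge (c : ℤ) (n n' M : ℕ) (k : ℤ)
    (hk : (2 * (Nat.sqrt M + 1) : ℤ) ≤ |k|) : fan c n n' M k = 0 := by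
  unfold fan
  refine sum_eq_zero fun j hj => sum_eq_zero fun p hp => ?_
  exfalso
  rw [mem_filter, mem_product, mem_Ioc, mem_Ioc] at hp
  rw [mem_Ico] at hj
  obtain ⟨⟨⟨h1, h2⟩, ⟨h3, h4⟩⟩, heq⟩ := hp
  have hQ : M < (Nat.sqrt M + 1) * (Nat.sqrt M + 1) := Nat.lt_succ_sqrt M
  have hQ' : (M : ℤ) < ((Nat.sqrt M + 1 : ℕ) : ℤ) * ((Nat.sqrt M + 1 : ℕ) : ℤ) := by exact_mod_cast hQ
  have hj' : ((Nat.sqrt M + 1 : ℕ) : ℤ) ≤ (j : ℤ) := by exact_mod_cast hj.1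
  have hk' : 2 * ((Nat.sqrt M + 1 : ℕ) : ℤ) ≤ |k| := by push_cast; exact_mod_cast hk
  have hkj : 2 * ((Nat.sqrt M + 1 : ℕ) : ℤ) * ((Nat.sqrt M + 1 : ℕ) : ℤ) ≤ |k| * (j : ℤ) :=
    mul_le_mul hk' hj' (by positivity) (abs_nonneg k)
  have habs : |(p.1 : ℤ) - p.2| = |k| * (j : ℤ) := by
    rw [heq, abs_mul, abs_of_nonneg (by positivity : (0 : ℤ) ≤ (j : ℤ))]
  have h1' : (M : ℤ) + 1 ≤ (p.1 : ℤ) := by exact_mod_cast h1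
  have h2' : (p.1 : ℤ) ≤ 2 * (M : ℤ) := by exact_mod_cast h2
  have h3' : (M : ℤ) + 1 ≤ (p.2 : ℤ) := by exact_mod_cast h3
  have h4' : (p.2 : ℤ) ≤ 2 * (M : ℤ) := by exact_mod_cast h4
  have hlt : |(p.1 : ℤ) - p.2| < M := abs_sub_lt_iff.mpr ⟨by linarith, by linarith⟩
  nlinarith

/-! ## §2 The joint floor -/

/-- **Joint floor at exponent 1/2 (MAD is not a pure square-root phenomenon).**  For every exponent
`e < 1/2` and every constant `C` there are a scale `M` and dilations `1 ≤ n ≠ n' ≤ 2M` (shift `c = 1`)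
at which EITHER some coset sum `T_j`, `j ∈ [Q,2Q)`, OR some fan sum `R_k`, `k ≠ 0`, exceeds `C·M^e`:
the two decorrelation cruxes `CosetDecorrelation`, `FanDecorrelation` cannot both hold with exponent
below `1/2`.  Proof: DivisorSwitch (`divisorSwitch_fan`) gives `Q·S = Σ_j T_j − Σ_{0<|k|≤M} R_k`; fans
vanish for `|k| ≥ 2Q` (`fan_eq_zero_of_abs_ge`), so at most `Q + (4Q−1) ≤ 5Q` terms survive, each
`≤ C·M^e`; the Welch floor (`exists_abs_S_ge_sqrt`) supplies `n ≠ n'` with `|S| ≥ √(M/2)`, whence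
`√(M/2) ≤ 5C·M^e`, false for `M^{1/2−e} > 5√2|C|`. [folklore] -/
theorem mad_not_both_below_half (e : ℝ) (he : e < 1 / 2) (C : ℝ) :
    ∃ M n n' : ℕ, 1 ≤ n ∧ 1 ≤ n' ∧ n ≠ n' ∧ n ≤ 2 * M ∧ n' ≤ 2 * M ∧
      ((∃ j : ℕ, Nat.sqrt M + 1 ≤ j ∧ j < 2 * (Nat.sqrt M + 1) ∧ C * (M : ℝ) ^ e < |coset 1 n n' M j|)
        ∨ ∃ k : ℤ, k ≠ 0 ∧ C * (M : ℝ) ^ e < |fan 1 n n' M k|) := by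
  by_contra hcon
  push Not at hcon
  -- choose the scale
  have hε : 0 < 1 / 2 - e := by linarith
  have ht : Tendsto (fun M : ℕ => (M : ℝ) ^ (1 / 2 - e)) atTop atTop :=
    (tendsto_rpow_atTop hε).comp tendsto_natCast_atTop_atTop
  obtain ⟨M, hM2, hMC⟩ :=
    ((eventually_ge_atTop 2).and (ht.eventually_gt_atTop (5 * Real.sqrt 2 * |C|))).exists
  have hM2' : (2 : ℝ) ≤ M := by exact_mod_cast hM2
  have hx : (0 : ℝ) < M := by linarith
  have habs : (|(1 : ℤ)| : ℝ) < M := by norm_num; linarith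
  -- the Welch pair
  obtain ⟨n, n', hn, hn', hne, hn2, hn2', hle⟩ := exists_abs_S_ge_sqrt 1 M habs
  obtain ⟨hcos, hfan⟩ := hcon M n n' hn hn' hne hn2 hn2'
  set Q' : ℕ := Nat.sqrt M + 1 with hQ'_def
  set B : ℝ := C * (M : ℝ) ^ e with hB_def
  have hQ'1 : 1 ≤ Q' := by omega
  have hB : 0 ≤ B := le_trans (abs_nonneg _) (hcos Q' le_rfl (by omega))
  -- cosets: `Σ_j |T_j| ≤ Q'·B`
  have hcos_sum : ∑ j ∈ Ico Q' (2 * Q'), |coset 1 n n' M j| ≤ (Q' : ℝ) * B := by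
    have h1 : ∑ j ∈ Ico Q' (2 * Q'), |coset 1 n n' M j| ≤ ∑ _j ∈ Ico Q' (2 * Q'), B :=
      sum_le_sum fun j hj => by
        rw [mem_Ico] at hj
        exact hcos j hj.1 hj.2
    have hcard : (Ico Q' (2 * Q')).card = Q' := by rw [Nat.card_Ico]; omega
    rwa [sum_const, hcard, nsmul_eq_mul] at h1
  -- fans: `Σ_{0<|k|≤M} |R_k| ≤ 4Q'·B`
  have hfan_sum : ∑ k ∈ (Icc (-(M : ℤ)) M).erase 0, |fan 1 n n' M k| ≤ 4 * (Q' : ℝ) * B := by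
    have h1 : ∑ k ∈ (Icc (-(M : ℤ)) M).erase 0, |fan 1 n n' M k| ≤
        ∑ k ∈ (Icc (-(M : ℤ)) M).erase 0, (if |k| < 2 * (Q' : ℤ) then B else 0) := by
      refine sum_le_sum fun k hk => ?_
      split_ifs with h
      · exact hfan k (ne_of_mem_erase hk)
      · rw [fan_eq_zero_of_abs_ge 1 n n' M k (by exact_mod_cast not_lt.mp h), abs_zero]
    have h2 : ∑ k ∈ (Icc (-(M : ℤ)) M).erase 0, (if |k| < 2 * (Q' : ℤ) then B else 0) =
        (((Icc (-(M : ℤ)) M).erase 0).filter (fun k : ℤ => |k| < 2 * (Q' : ℤ))).card * B := by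
      rw [← sum_filter, sum_const, nsmul_eq_mul]
    have h3 : (((Icc (-(M : ℤ)) M).erase 0).filter (fun k : ℤ => |k| < 2 * (Q' : ℤ))).card ≤
        (Ioo (-(2 * (Q' : ℤ))) (2 * (Q' : ℤ))).card := by
      refine card_le_card fun k hk => ?_
      rw [mem_filter] at hk
      rw [mem_Ioo]
      exact abs_lt.mp hk.2
    have h4 : ((Ioo (-(2 * (Q' : ℤ))) (2 * (Q' : ℤ))).card : ℝ) ≤ 4 * (Q' : ℝ) := by
      rw [Int.card_Ioo]
      have : (2 * (Q' : ℤ) - -(2 * (Q' : ℤ)) - 1).toNat = 4 * Q' - 1 := by omega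
      rw [this]
      have h5 : ((4 * Q' - 1 : ℕ) : ℝ) ≤ ((4 * Q' : ℕ) : ℝ) := by exact_mod_cast Nat.sub_le _ _
      push_cast at h5
      exact h5
    have h3' : ((((Icc (-(M : ℤ)) M).erase 0).filter (fun k : ℤ => |k| < 2 * (Q' : ℤ))).card : ℝ) ≤
        4 * (Q' : ℝ) := le_trans (by exact_mod_cast h3) h4
    calc ∑ k ∈ (Icc (-(M : ℤ)) M).erase 0, |fan 1 n n' M k|
        ≤ (((Icc (-(M : ℤ)) M).erase 0).filter (fun k : ℤ => |k| < 2 * (Q' : ℤ))).card * B :=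
          h1.trans h2.le
      _ ≤ 4 * (Q' : ℝ) * B := mul_le_mul_of_nonneg_right h3' hB
  -- DivisorSwitch: `Q'·|S| ≤ Σ|T_j| + Σ|R_k| ≤ 5Q'·B`
  have hDS := divisorSwitch_fan 1 n n' M
  have hQ'R : ((Nat.sqrt M : ℝ) + 1) = (Q' : ℝ) := by rw [hQ'_def]; push_cast; ring
  rw [hQ'R] at hDS
  have hQS : (Q' : ℝ) * |S 1 n n' M| ≤ 5 * (Q' : ℝ) * B := by
    have h1 : (Q' : ℝ) * S 1 n n' M =
        ∑ j ∈ Ico Q' (2 * Q'), coset 1 n n' M j - ∑ k ∈ (Icc (-(M : ℤ)) M).erase 0, fan 1 n n' M k := by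
      rw [← hDS]; ring
    calc (Q' : ℝ) * |S 1 n n' M| = |(Q' : ℝ) * S 1 n n' M| := by
          rw [abs_mul, abs_of_nonneg (by positivity : (0 : ℝ) ≤ (Q' : ℝ))]
      _ ≤ |∑ j ∈ Ico Q' (2 * Q'), coset 1 n n' M j| +
            |∑ k ∈ (Icc (-(M : ℤ)) M).erase 0, fan 1 n n' M k| := by
          rw [h1]; exact abs_sub _ _
      _ ≤ ∑ j ∈ Ico Q' (2 * Q'), |coset 1 n n' M j| +
            ∑ k ∈ (Icc (-(M : ℤ)) M).erase 0, |fan 1 n n' M k| :=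
          add_le_add (abs_sum_le_sum_abs _ _) (abs_sum_le_sum_abs _ _)
      _ ≤ (Q' : ℝ) * B + 4 * (Q' : ℝ) * B := add_le_add hcos_sum hfan_sum
      _ = 5 * (Q' : ℝ) * B := by ring
  have hQ'pos : (0 : ℝ) < Q' := by exact_mod_cast hQ'1
  have hS : |S 1 n n' M| ≤ 5 * B := by
    have : (Q' : ℝ) * |S 1 n n' M| ≤ (Q' : ℝ) * (5 * B) := by linarith
    exact le_of_mul_le_mul_left this hQ'pos
  -- `√(M/2) ≤ 5 C M^e ≤ 5|C| M^e`, against `M^{1/2-e} > 5√2|C|`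
  have key : Real.sqrt ((M : ℝ) / 2) ≤ 5 * |C| * (M : ℝ) ^ e := by
    calc Real.sqrt ((M : ℝ) / 2) ≤ 5 * B := hle.trans hS
      _ = 5 * C * (M : ℝ) ^ e := by rw [hB_def]; ring
      _ ≤ 5 * |C| * (M : ℝ) ^ e := by
          have := le_abs_self C
          have h0 : (0 : ℝ) ≤ (M : ℝ) ^ e := by positivity
          nlinarith
  rw [Real.sqrt_div' _ zero_le_two, Real.sqrt_eq_rpow (M : ℝ),
    div_le_iff₀ (Real.sqrt_pos.mpr zero_lt_two)] at key
  have hMC' : 5 * Real.sqrt 2 * |C| < (M : ℝ) ^ (1 / 2 : ℝ) / (M : ℝ) ^ e := by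
    rw [← Real.rpow_sub hx]
    exact hMC
  rw [lt_div_iff₀ (Real.rpow_pos_of_pos hx _)] at hMC'
  nlinarith [Real.sqrt_nonneg 2, abs_nonneg C, Real.rpow_pos_of_pos hx e,
    Real.sq_sqrt (show (0:ℝ) ≤ 2 by norm_num)]

/-- **MAD exponent floor.**  For no `e < 1/2` can BOTH decorrelation bounds hold with `M^e` in place
of `M^{3/4+ϑ}` — already at the single shift `c = 1`. -/
theorem mad_exponent_floor (e : ℝ) (he : e < 1 / 2) :
    ¬ ((∃ C : ℝ, ∀ M n n' j : ℕ, 1 ≤ n → 1 ≤ n' → n ≠ n' → n ≤ 2 * M → n' ≤ 2 * M →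
          Nat.sqrt M + 1 ≤ j → j < 2 * (Nat.sqrt M + 1) → |coset 1 n n' M j| ≤ C * (M : ℝ) ^ e) ∧
       (∃ C : ℝ, ∀ M n n' : ℕ, ∀ k : ℤ, 1 ≤ n → 1 ≤ n' → n ≠ n' → n ≤ 2 * M → n' ≤ 2 * M →
          k ≠ 0 → |fan 1 n n' M k| ≤ C * (M : ℝ) ^ e)) := by
  rintro ⟨⟨C₁, h₁⟩, ⟨C₂, h₂⟩⟩
  obtain ⟨M, n, n', hn, hn', hne, hn2, hn2', h⟩ := mad_not_both_below_half e he (max C₁ C₂)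
  have hM : (0 : ℝ) ≤ (M : ℝ) ^ e := by positivity
  rcases h with ⟨j, hj1, hj2, hlt⟩ | ⟨k, hk, hlt⟩
  · have := h₁ M n n' j hn hn' hne hn2 hn2' hj1 hj2
    have : C₁ * (M : ℝ) ^ e ≤ max C₁ C₂ * (M : ℝ) ^ e :=
      mul_le_mul_of_nonneg_right (le_max_left _ _) hM
    linarith
  · have := h₂ M n n' k hn hn' hne hn2 hn2' hk
    have : C₂ * (M : ℝ) ^ e ≤ max C₁ C₂ * (M : ℝ) ^ e :=
      mul_le_mul_of_nonneg_right (le_max_right _ _) hM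
    linarith

end Summit.Parity.GeneralizedHardyLittlewood.Theorems.FanDecorrelation.Negative

end
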